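import Literature.Barriers.ValiantsHypothesis.NotViaSaturationsChowNormal
import Literature.NumberTheory.DiophantineGeometry.SymmetricGroupRepsFinrankSpechtProofs
import Mathlib.LinearAlgebra.Vandermonde
import Mathlib.LinearAlgebra.Matrix.Block
import HarnessLib

/-!
# Even partitions in plethysms (Bürgisser–Christandl–Ikenmeyer 2011): the discharge of
# `BCI2011_evenPlethysm`

P. Bürgisser, M. Christandl, C. Ikenmeyer, *Even partitions in plethysms*, J. Algebra 328 (2011)
322–329 = arXiv:1003.4474, Theorem (§1.1): "For all `k,n,d ∈ ℕ` with `k ≤ d` and for all partitions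
`λ` of size `kn` with at most `k` parts, the irreducible `GL_d`-representation `{2λ}` of highest
weight `2λ` occurs in the plethysm `Sym^k(Sym^{2n}ℂ^d)`" (Weintraub's conjecture). This file PROVES
the named fact `BCI2011_evenPlethysm` of `NotViaSaturationsChowNormal.lean` (the weight form, in
the tree's model `symSymOcc d (2n)`: a nonzero highest-weight vector of weight `(2χ)^*` in
`ℂ[Sym^{2n} ℂ^d] = ⊕_δ Sym^δ(Sym^{2n} ℂ^d)^*`, `coordRep`): `BCI2011_evenPlethysm_holds`.

## The printed proof (§§2–3) and how it is read here

BCI, §3: with `V = ℂ^d`, `T = V^{⊗2nk}`, `S = Sym^k(Sym^{2n}V) ⊆ T`, it suffices (Lemma 2.5,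
orthogonality of isotypic components) to find `|ψ⟩ ∈ S` and `|v⟩` in the isotypic component
`2λ(T)` with `⟨v|ψ⟩ ≠ 0`. They take the highest-weight vector `|v_λ⟩ = ⊗_columns` (Slater
determinants) of (2.4), a vector `|u⟩ = ∑_π α_π π|1^{⊗n}⋯k^{⊗n}⟩ ∈ {λ}` (Lemma 2.6, from the
Kostka number `K_{λ,(n^k)} > 0`, Lemma 2.1), a REAL matrix `g` with `f(g) = ⟨v_λ|g|u⟩ ≠ 0`
(irreducibility of `{λ}` and Zariski density of `ℝ^{d×d}`, Lemma 2.7), hence `π` with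
`⟨v_λ| g π |1^{⊗n}⋯k^{⊗n}⟩ ≠ 0`; then `|w⟩ = π⁻¹g⁻¹|v_λ⟩` (a coherent state, real coefficients),
`|v⟩ = σ|w⟩^{⊗2}` (`σ` sorting odd and even letters; `|w⟩|w⟩ ∈ 2λ(T)` by Lemma 2.2 / Cor. 2.4),
`|ψ⟩ = (∑_i |i⟩^{⊗2n})^{⊗k}`, and
`⟨v|ψ⟩ = ∑_{i_1,…,i_k} ⟨w|i_1^{⊗n}⋯i_k^{⊗n}⟩² > 0` (eq. (sumofsquares)).

The formalisation keeps this mechanism and makes the two non-constructive choices explicit, which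
turns the argument into the exhibition of a highest-weight vector (as `symSymOcc` demands); no
definition is introduced, the objects below live inside the proof of
`exists_wreathInvariant_hwv_two_nsmul`:

* since `g` commutes with the position permutations and with the projection `P : T → S` (the wreath
  symmetriser `blockSymmetrizer` of `PlethysmStability.lean`), `P|v⟩ = g⁻¹ P σ(π⁻¹|v_λ⟩)^{⊗2}` and
  `σ(π⁻¹|v_λ⟩)^{⊗2}` IS a highest-weight vector of weight `2λ` (Lemma 2.2,
  `tensorPow_mem_highestWeightSpace`); so BCI's inequality says that the wreath symmetrisation `x`
  of the tensor square (along a block-preserving doubling equivalence, `exists_dblEquiv`) of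
  `v = π⁻¹|v_λ⟩` is NONZERO — and `x` is an `S_k ≀ S_{2n}`-invariant highest-weight vector of weight
  `2λ`, i.e. an element of `HWV_{2λ}(Sym^k Sym^{2n} V)`;
* `⟨v_λ| g π |1^{⊗n}⋯k^{⊗n}⟩` is, as a function of `g`, the product over the columns of `λ` of the
  minors of `g` on the rows "blocks met by the column" and the columns `0, …, (length − 1)`; it is
  nonzero iff no column of `λ` meets a block twice. Explicit choice: `|v_λ⟩` is the polytabloid of
  the COLUMN-READING tableau (`exists_colReading`: boxes numbered column by column) and `π` sends box
  number `t` to block `t mod k` (`exists_mixPerm`) — a column has `≤ k` consecutive numbers, hence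
  distinct blocks, and every block receives exactly `n` boxes; `g` is the Vandermonde matrix
  `((a+1)^j)` (`exists_vandGL`), whose relevant minors are Vandermonde determinants on distinct
  nodes (`sum_colStab_sign_mul_prod_pow_ne_zero`, via `sum_colStab_sign_mul_prod_eq_det`, Mathlib's
  `Matrix.BlockTriangular.det` for the block-diagonal column matrix, `det_colMatrix_eq_prod`, and
  `Matrix.det_vandermonde_ne_zero_iff`, `det_colBlock_ne_zero`);
* realness: all coefficients are integers (`wordRep_polytabloid_apply_eq_intCast`), and the sum
  over the block-constant words `u_i = (q ↦ i(block of q))` (BCI's `∑_{i_1,…,i_k}`) of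
  `(g · x)(u_i)` equals `|S_k ≀ S_{2n}| · ∑_i ⟨u_i|g|v⟩²` (`sum_wordRep_blockSymmetrizer_tensorSquare`;
  the factor comes from the symmetrisation, using that `∑_i` is invariant under the wreath product,
  `sum_blockWord_comp_eq`), with `⟨u_{id}|g|v⟩ ≠ 0` — so `x ≠ 0`.

Finally the dictionary `formOfWord` of `PlethysmStability.lean` (BIP 2019 (4.1): `Sym^k Sym^{2n} V =
(⊗^{2nk} V)^{S_k ≀ S_{2n}}`, read through `Fin.rev` so that the `coordRep` weight is the dual one)
turns `x` into the required nonzero highest-weight vector of `ℂ[Sym^{2n} ℂ^d]_k` of weight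
`(2χ)^*` (`two_nsmul_mem_symSymOcc_of_exists`); the degenerate cases `k = 0` or `n = 0` (`χ = 0`)
are witnessed by the constants. Sections B–E are stated over a general field; the vector itself is
built over `ℂ` because `symSymOcc` is.

## References

* [BurgisserChristandlIkenmeyer2011Even] P. Bürgisser, M. Christandl, C. Ikenmeyer, J. Algebra 328
  (2011) 322–329 = arXiv:1003.4474: Theorem (§1.1); §2.1 Lemma 2.1; §2.3 Lemma 2.2, Def. 2.3,
  Cor. 2.4, Lemma 2.5; §2.4 (the vectors `|v_k⟩`, `|v_λ⟩`), Lemma 2.6, Lemma 2.7; §3 (proof of the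
  Theorem, eqs. (fdef), (sumofsquares)).
* [BurgisserIkenmeyerPanovaJAMS2019] P. Bürgisser, C. Ikenmeyer, G. Panova, J. AMS 32 (2019), §4
  (4.1) (the plethysm as wreath-product invariants; the dictionary of `PlethysmStability.lean`).
* W. Fulton, *Young Tableaux*, LMS Student Texts 35, §7.2, §8.1 (polytabloids as highest-weight
  vectors; the tree's `StdFilling.polytabloid_mem`). [folklore]

## Tree and Mathlib

Tree: `wordRep`, `wordPerm`, `wordPerm_wordRep`, `wordRep_single` (`TensorWordModel`);
`StdFilling`, `StdFilling.rowReading`, `polytabloid`, `polytabloid_mem`, `colAntisym_wordRep`,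
`ydWeight_youngDiagram` (`SchurWeylPlethysmHwMultiplicityProofs`, `SymmetricGroupRepsFinrankSpechtProofs`);
`Nat.Partition.rowOf/colOf/transpose`, `youngDiagram_transpose` (`PartitionTableaux`); `blockIdx`,
`blockPerms`, `blockSymmetrizer`, `formOfWord`, `formOfWord_mem_highestWeightSpace`,
`formOfWord_ne_zero` (`PlethysmStability`); `Weight.existsUnique_eq_ofPartition_holds`
(`GLHighestWeightFacts`); `symSymOcc` (`NotViaSaturationsChowNormal`). Mathlib: `finProdFinEquiv`,
`Matrix.vandermonde`, `Matrix.det_vandermonde_ne_zero_iff`, `Matrix.BlockTriangular.det`,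
`Matrix.toSquareBlock`, `Matrix.det_submatrix_equiv_self`, `Matrix.GeneralLinearGroup.mkOfDetNeZero`,
`YoungDiagram.colLen`.
-/

noncomputable section

open scoped BigOperators

namespace Literature.Barriers.ValiantsHypothesis

open Literature.NumberTheory.DiophantineGeometry Literature.Computability.AlgebraicComplexity

/-! ### A. The column-reading standard tableau -/

section ColReading


variable {D : ℕ}

/-- The **column-reading tableau** of shape `μ` exists: numbering the boxes of the Young diagram
`0, …, D-1` column by column (the row-reading tableau of the transpose partition, transposed) is a
standard tableau in which two entries of one column differ by the difference of their rows,
`i + row j = j + row i` (so a column with rows `< K` occupies `< K` consecutive numbers). [folklore] -/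
theorem exists_colReading (μ : Nat.Partition D) :
    ∃ T : StdFilling D μ.youngDiagram, ∀ i j : Fin D, (T.1 i).2 = (T.1 j).2 →
      (i : ℕ) + (T.1 j).1 = (j : ℕ) + (T.1 i).1 := by
  refine ⟨⟨fun i => (μ.transpose.colOf i, μ.transpose.rowOf i), ?_⟩, fun i j h => ?_⟩
  · refine ⟨fun i => ?_, fun i j h => ?_, fun i j hij hle => ?_⟩
    · have h := μ.transpose.rowOf_colOf_mem_youngDiagram i
      rw [Nat.Partition.youngDiagram_transpose, YoungDiagram.mem_transpose] at h
      exact h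
    · simp only [Prod.mk.injEq] at h
      refine (StdFilling.rowReading μ.transpose).injective ?_
      rw [StdFilling.rowReading_apply, StdFilling.rowReading_apply, h.1, h.2]
    · rw [Prod.mk_le_mk] at hle
      refine (StdFilling.rowReading μ.transpose).not_le hij ?_
      rw [StdFilling.rowReading_apply, StdFilling.rowReading_apply, Prod.mk_le_mk]
      exact ⟨hle.2, hle.1⟩
  · change μ.transpose.rowOf i = μ.transpose.rowOf j at h
    change (i : ℕ) + μ.transpose.colOf j = (j : ℕ) + μ.transpose.colOf i
    have hi := μ.transpose.val_eq_sum_take_rowOf_add_colOf i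
    have hj := μ.transpose.val_eq_sum_take_rowOf_add_colOf j
    rw [h] at hi
    omega

end ColReading

/-! ### B. Tensor powers in the word model -/

section TensorPow

variable (k : Type*) [Field k] {N L L₁ r : ℕ}

/-- **The action of `GL_N` on a tensor power factors** (`g^{⊗L} = ⊗_c g^{⊗L₁}`). The `r`-fold
tensor power of a function `v` on words of length `L₁`, placed on the positions of words of length
`L` along `Θ : Fin r × Fin L₁ ≃ Fin L`, is `w ↦ ∏_c v(q ↦ w (Θ (c, q)))`, and for every `g`,
`(g · v^{⊗r})(w') = ∏_c (g · v)(w'|_c)`. [cite: BurgisserChristandlIkenmeyer2011Even, Lemma 2.2 (proof)] -/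
theorem wordRep_tensorPow (Θ : Fin r × Fin L₁ ≃ Fin L) (g : GL (Fin N) k) (v : Word N L₁ → k)
    (w' : Word N L) :
    wordRep k N L g (fun w => ∏ c : Fin r, v fun q => w (Θ (c, q))) w' =
      ∏ c : Fin r, wordRep k N L₁ g v fun q => w' (Θ (c, q)) := by
  classical
  simp only [wordRep_apply]
  rw [Fintype.prod_sum]
  -- reindex words of length `L` by `r`-tuples of words of length `L₁`
  let e : Word N L ≃ (Fin r → Word N L₁) :=
    (Θ.symm.arrowCongr (Equiv.refl (Fin N))).trans (Equiv.curry (Fin r) (Fin L₁) (Fin N))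
  refine Fintype.sum_equiv e _ _ fun w => ?_
  rw [Finset.prod_mul_distrib]
  congr 1
  symm
  rw [← Fintype.prod_prod_type' (f := fun c q => (g : Matrix (Fin N) (Fin N) k) (w' (Θ (c, q))) (e w c q))]
  exact Fintype.prod_equiv Θ _ _ fun x => rfl

/-- The weight character of a multiple of a weight (local copy of the `Chow*` lemma). [folklore] -/
theorem weightChar_nsmul' (m : ℕ) (χ : Weight (Fin N)) {b : GL (Fin N) k} (hb : IsUpperTriangular b) :
    weightChar (m • χ) b = weightChar χ b ^ m := by
  induction m with
  | zero =>
    rw [zero_smul, pow_zero, weightChar]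
    exact Finset.prod_eq_one fun i _ => by rw [Pi.zero_apply, zpow_zero]
  | succ m ih => rw [succ_nsmul, weightChar_add _ _ hb, ih, pow_succ]

variable {k}

/-- **Tensor powers of highest-weight vectors are highest-weight vectors** of the multiple weight
(BCI Lemma 2.2 / Cor. 2.4: `|w⟩|w⟩` lies in the component `2λ`). [cite: BurgisserChristandlIkenmeyer2011Even, Lemma 2.2] -/
theorem tensorPow_mem_highestWeightSpace (Θ : Fin r × Fin L₁ ≃ Fin L) {χ : Weight (Fin N)}
    {v : Word N L₁ → k} (hv : v ∈ highestWeightSpace (wordRep k N L₁) χ) :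
    (fun w : Word N L => ∏ c : Fin r, v fun q => w (Θ (c, q))) ∈
      highestWeightSpace (wordRep k N L) (r • χ) := by
  intro b hb
  funext w'
  rw [wordRep_tensorPow, hv b hb, Pi.smul_apply, smul_eq_mul, weightChar_nsmul' k r χ hb]
  simp only [Pi.smul_apply, smul_eq_mul]
  rw [Finset.prod_mul_distrib, Finset.prod_const, Finset.card_univ, Fintype.card_fin]

end TensorPow

/-! ### C. Block permutations and block-constant words -/

section Blocks

variable {k : Type*} [Field k] {N K m : ℕ}

/-- A permutation of the wreath product `S_K ≀ S_m` induces a permutation of the blocks.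
[cite: BurgisserIkenmeyerPanovaJAMS2019, §4] -/
theorem exists_perm_blockIdx_eq (hm : 0 < m) {τ : Equiv.Perm (Fin (K * m))}
    (hτ : τ ∈ blockPerms K m) :
    ∃ π : Equiv.Perm (Fin K), ∀ q, blockIdx K m (τ q) = π (blockIdx K m q) := by
  set p₀ : Fin m := ⟨0, hm⟩
  let π₀ : Fin K → Fin K := fun b => blockIdx K m (τ (finProdFinEquiv (b, p₀)))
  have hblk : ∀ b p, blockIdx K m (τ (finProdFinEquiv (b, p))) = π₀ b := fun b p => by
    show blockIdx K m (τ (finProdFinEquiv (b, p))) = blockIdx K m (τ (finProdFinEquiv (b, p₀)))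
    rw [mem_blockPerms.mp hτ]
    simp
  have hπ₀ : Function.Injective π₀ := by
    intro b b' hbb'
    have h1 : blockIdx K m (τ (finProdFinEquiv (b, p₀))) =
        blockIdx K m (τ (finProdFinEquiv (b', p₀))) := hbb'
    rw [mem_blockPerms.mp hτ] at h1
    simpa using h1
  refine ⟨Equiv.ofBijective π₀ (Finite.injective_iff_bijective.mp hπ₀), fun q => ?_⟩
  obtain ⟨⟨b, p⟩, rfl⟩ := finProdFinEquiv.surjective q
  rw [hblk, Equiv.ofBijective_apply, blockIdx_finProdFinEquiv]

/-- **Summing over all block-constant words `u_i = (q ↦ i(block of q))` is invariant under the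
wreath product**: `∑_i f(u_i ∘ τ) = ∑_i f(u_i)` for `τ ∈ S_K ≀ S_m` (`u_i ∘ τ = u_{i ∘ π_τ}` and
`i ↦ i ∘ π_τ` is a bijection); the `u_i` are BCI's `|i_1^{⊗m} ⋯ i_K^{⊗m}⟩`.
[cite: BurgisserChristandlIkenmeyer2011Even, §3 (eq. sumofsquares)] -/
theorem sum_blockWord_comp_eq {M : Type*} [AddCommMonoid M] (hm : 0 < m)
    {τ : Equiv.Perm (Fin (K * m))} (hτ : τ ∈ blockPerms K m) (f : Word N (K * m) → M) :
    ∑ i : Fin K → Fin N, f ((fun q => i (blockIdx K m q)) ∘ ⇑τ) =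
      ∑ i : Fin K → Fin N, f fun q => i (blockIdx K m q) := by
  obtain ⟨π, hπ⟩ := exists_perm_blockIdx_eq hm hτ
  have hcomp : ∀ i : Fin K → Fin N,
      (fun q => i (blockIdx K m q)) ∘ ⇑τ = fun q => (i ∘ ⇑π) (blockIdx K m q) := fun i => by
    funext q
    simp only [Function.comp_apply, hπ q]
  simp_rw [hcomp]
  exact Equiv.sum_comp (π.arrowCongr (Equiv.refl (Fin N))).symm
    (fun i : Fin K → Fin N => f fun q => i (blockIdx K m q))

/-- The action of `GL_N` commutes with the wreath symmetriser. [cite: BurgisserIkenmeyerPanovaJAMS2019, §4 (4.1)] -/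
theorem wordRep_blockSymmetrizer (g : GL (Fin N) k) (x : Word N (K * m) → k) :
    wordRep k N (K * m) g (blockSymmetrizer k K m x) = blockSymmetrizer k K m (wordRep k N (K * m) g x) := by
  rw [blockSymmetrizer, LinearMap.sum_apply, LinearMap.sum_apply, map_sum]
  exact Finset.sum_congr rfl fun τ _ => (wordPerm_wordRep k τ g x).symm

end Blocks

/-! ### D. The mixing permutation and the doubling equivalence -/

section Mixing

variable (K n : ℕ)

/-- **The mixing permutation** of the positions `[K·n]` exists: position `t` goes to the block
`t mod K` (place `t / K`). [folklore] -/
theorem exists_mixPerm :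
    ∃ π : Equiv.Perm (Fin (K * n)), ∀ t, (blockIdx K n (π t) : ℕ) = (t : ℕ) % K :=
  ⟨((finCongr (Nat.mul_comm K n)).trans finProdFinEquiv.symm).trans
      ((Equiv.prodComm (Fin n) (Fin K)).trans finProdFinEquiv),
    fun t => by simp [blockIdx_finProdFinEquiv]⟩

/-- **The doubling equivalence** `Fin 2 × [K·n] ≃ [K·(2n)]` exists: `(c, (b, j)) ↦ (b, (c, j))`,
copy `c` of place `j` of block `b` is place `(c, j)` of block `b`, so that blocks are preserved
(BCI's permutation `σ` sorting odd and even letters). [cite: BurgisserChristandlIkenmeyer2011Even, §3 (the permutation sigma)] -/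
theorem exists_dblEquiv :
    ∃ Θ : Fin 2 × Fin (K * n) ≃ Fin (K * (2 * n)),
      ∀ c q, blockIdx K (2 * n) (Θ (c, q)) = blockIdx K n q := by
  refine ⟨(Equiv.prodCongr (Equiv.refl (Fin 2)) finProdFinEquiv.symm).trans <|
    ((Equiv.prodAssoc (Fin 2) (Fin K) (Fin n)).symm).trans <|
      (Equiv.prodCongr (Equiv.prodComm (Fin 2) (Fin K)) (Equiv.refl (Fin n))).trans <|
        (Equiv.prodAssoc (Fin K) (Fin 2) (Fin n)).trans <|
          (Equiv.prodCongr (Equiv.refl (Fin K)) finProdFinEquiv).trans finProdFinEquiv, fun c q => ?_⟩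
  obtain ⟨⟨b, j⟩, rfl⟩ := finProdFinEquiv.surjective q
  simp [blockIdx_finProdFinEquiv]

end Mixing

/-! ### E. Column determinants: the value of a polytabloid under a matrix -/

section ColDet

variable {k : Type*} [Field k] {N D : ℕ} {Y : YoungDiagram}

/-- **The action of `g` on a polytabloid, evaluated at a word**:
`(g · e_T)(s) = ∑_{σ ∈ C_T} sgn σ ∏_t g_{s(σ t), row t}` (`κ_T` commutes with `g`, and
`(g · δ_u)(w') = ∏_t g_{w' t, u t}`). This is BCI's matrix coefficient `⟨s| g |v_λ⟩` (the
function `f(g)` of §3). [cite: BurgisserChristandlIkenmeyer2011Even, §3 (eq. fdef)] -/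
theorem wordRep_polytabloid_apply (hN : ∀ x ∈ Y.cells, x.1 < N) (T : StdFilling D Y)
    (g : GL (Fin N) k) (s : Word N D) :
    wordRep k N D g (T.polytabloid k hN) s =
      ∑ σ ∈ T.colStab, ((Equiv.Perm.sign σ : ℤ) : k) *
        ∏ t, (g : Matrix (Fin N) (Fin N) k) (s (σ t)) (T.rowWord hN t) := by
  rw [StdFilling.polytabloid, ← StdFilling.colAntisym_wordRep, StdFilling.colAntisym_apply,
    Finset.sum_apply]
  refine Finset.sum_congr rfl fun σ _ => ?_
  rw [Pi.smul_apply, wordPerm_apply, smul_eq_mul, wordRep_single]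
  rfl

variable {R : Type*} [CommRing R]

/-- **A signed sum over the column stabiliser is a block-diagonal determinant**:
`∑_{σ ∈ C_T} sgn σ ∏_t f(σ t, t) = det (f(t', t) [t', t in one column])` (the other permutations
contribute a zero factor). [folklore] -/
theorem sum_colStab_sign_mul_prod_eq_det (T : StdFilling D Y) (f : Fin D → Fin D → R) :
    ∑ σ ∈ T.colStab, ((Equiv.Perm.sign σ : ℤ) : R) * ∏ t, f (σ t) t =
      (Matrix.of fun t' t => if (T.1 t').2 = (T.1 t).2 then f t' t else 0).det := by
  classical
  rw [Matrix.det_apply]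
  symm
  rw [← Finset.sum_subset (Finset.subset_univ T.colStab)]
  · refine Finset.sum_congr rfl fun σ hσ => ?_
    rw [Units.smul_def, zsmul_eq_mul]
    congr 1
    refine Finset.prod_congr rfl fun t _ => ?_
    rw [Matrix.of_apply, if_pos (StdFilling.mem_colStab.1 hσ t)]
  · intro σ _ hσ
    rw [StdFilling.mem_colStab] at hσ
    push Not at hσ
    obtain ⟨t, ht⟩ := hσ
    rw [Finset.prod_eq_zero (Finset.mem_univ t) (by rw [Matrix.of_apply, if_neg ht]), smul_zero]

/-- The column matrix is block triangular (indeed block diagonal) for the column index, and its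
diagonal blocks are the matrices `(f t' t)_{t', t ∈ column a}`; hence its determinant is the
product of theirs. [folklore] -/
theorem det_colMatrix_eq_prod (T : StdFilling D Y) (f : Fin D → Fin D → R) :
    (Matrix.of fun t' t => if (T.1 t').2 = (T.1 t).2 then f t' t else 0).det =
      ∏ a ∈ Finset.univ.image fun t => (T.1 t).2,
        (Matrix.of fun t' t : {t // (T.1 t).2 = a} => f t' t).det := by
  classical
  have hB : (Matrix.of fun t' t => if (T.1 t').2 = (T.1 t).2 then f t' t else 0).BlockTriangular
      fun t => (T.1 t).2 := fun t' t hlt => by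
    rw [Matrix.of_apply, if_neg (ne_of_gt hlt)]
  rw [hB.det]
  refine Finset.prod_congr rfl fun a _ => ?_
  congr 1
  ext t' t
  rw [Matrix.toSquareBlock_def, Matrix.of_apply, Matrix.of_apply, Matrix.of_apply,
    if_pos (t'.2.trans t.2.symm)]

/-- **The column Vandermonde determinants.** For nodes `x` injective on the column `a` of a
standard tableau of full shape, `det (x_{t'} ^ {row t})_{t', t ∈ column a} ≠ 0`: the rows of the
column are exactly `0, …, L-1`, so this is a Vandermonde determinant on distinct nodes.
[folklore] -/
theorem det_colBlock_ne_zero {F : Type*} [Field F] (hd : Y.cells.card = D) (T : StdFilling D Y)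
    (x : Fin D → F) (a : ℕ)
    (hx : ∀ t t' : Fin D, (T.1 t).2 = a → (T.1 t').2 = a → x t = x t' → t = t') :
    (Matrix.of fun t' t : {t // (T.1 t).2 = a} => x t' ^ (T.1 t).1).det ≠ 0 := by
  classical
  set L := Y.colLen a with hL
  have hrow : ∀ t : {t // (T.1 t).2 = a}, (T.1 t.1).1 < L := fun t => by
    have h : ((T.1 t.1).1, (T.1 t.1).2) ∈ Y := T.mem t.1
    rw [t.2] at h
    exact YoungDiagram.mem_iff_lt_colLen.mp h
  let ψ : {t // (T.1 t).2 = a} → Fin L := fun t => ⟨(T.1 t.1).1, hrow t⟩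
  have hψv : ∀ t, ((ψ t : Fin L) : ℕ) = (T.1 t.1).1 := fun t => rfl
  have hψinj : Function.Injective ψ := by
    intro t t' h
    have h1 : (T.1 t.1).1 = (T.1 t'.1).1 := by rw [← hψv t, ← hψv t', h]
    exact Subtype.ext (T.injective (Prod.ext h1 (t.2.trans t'.2.symm)))
  have hψsurj : Function.Surjective ψ := by
    intro i
    have hmem : ((i : ℕ), a) ∈ Y := YoungDiagram.mem_iff_lt_colLen.mpr i.2
    obtain ⟨t, ht⟩ := T.exists_eq hd hmem
    refine ⟨⟨t, by rw [ht]⟩, Fin.ext ?_⟩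
    rw [hψv]
    simp only [ht]
  let ψe : {t // (T.1 t).2 = a} ≃ Fin L := Equiv.ofBijective ψ ⟨hψinj, hψsurj⟩
  have hψe : ∀ t, ((ψe t : Fin L) : ℕ) = (T.1 t.1).1 := fun t => rfl
  let u : Fin L → F := fun i => x (ψe.symm i).1
  have hM : (Matrix.of fun t' t : {t // (T.1 t).2 = a} => x t' ^ (T.1 t).1) =
      (Matrix.vandermonde u).submatrix ψe ψe := by
    ext t' t
    simp only [Matrix.of_apply, Matrix.submatrix_apply, Matrix.vandermonde_apply, u,
      Equiv.symm_apply_apply, hψe]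
  rw [hM, Matrix.det_submatrix_equiv_self, Matrix.det_vandermonde_ne_zero_iff]
  intro i j hij
  have h := hx _ _ (ψe.symm i).2 (ψe.symm j).2 hij
  exact ψe.symm.injective (Subtype.ext h)

end ColDet

/-! ### F. The vector `P σ(π⁻¹v_λ)^{⊗2}` in the word model and its nonvanishing -/

section Core

variable {N K n D : ℕ} {Y : YoungDiagram}

/-- **BCI's real matrix `g`**, chosen as the Vandermonde matrix `((a+1)^j)_{a,j} ∈ GL_N(ℂ)`
(invertible: distinct nodes). [cite: BurgisserChristandlIkenmeyer2011Even, §3 (the real matrix g with f(g) nonzero)] -/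
theorem exists_vandGL (N : ℕ) : ∃ g : GL (Fin N) ℂ,
    ∀ a j, (g : Matrix (Fin N) (Fin N) ℂ) a j = (((a : ℕ) : ℂ) + 1) ^ (j : ℕ) := by
  have hinj : Function.Injective fun a : Fin N => ((a : ℕ) : ℂ) + 1 := by
    intro a b h
    simp only [add_left_inj, Nat.cast_inj] at h
    exact Fin.ext h
  exact ⟨Matrix.GeneralLinearGroup.mkOfDetNeZero (Matrix.vandermonde fun a : Fin N => ((a : ℕ) : ℂ) + 1)
      (Matrix.det_vandermonde_ne_zero_iff.mpr hinj), fun a j => by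
    rw [Matrix.GeneralLinearGroup.val_mkOfDetNeZero, Matrix.vandermonde_apply]⟩

/-- **`⟨s| g |v_λ⟩` is an integer** for the Vandermonde `g`: `∑_{σ ∈ C_T} sgn σ ∏_t (s(σ t)+1)^{row t}`
(BCI: "`|w⟩` has only real coefficients", which is essential for the sum of squares).
[cite: BurgisserChristandlIkenmeyer2011Even, §3 (the real coefficients of w)] -/
theorem wordRep_polytabloid_apply_eq_intCast (hN : ∀ x ∈ Y.cells, x.1 < N) (T : StdFilling D Y)
    {g : GL (Fin N) ℂ} (hg : ∀ a j, (g : Matrix (Fin N) (Fin N) ℂ) a j = (((a : ℕ) : ℂ) + 1) ^ (j : ℕ))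
    (s : Word N D) :
    wordRep ℂ N D g (T.polytabloid ℂ hN) s =
      ((∑ σ ∈ T.colStab, (Equiv.Perm.sign σ : ℤ) *
        ∏ t, (((s (σ t) : Fin N) : ℕ) + 1 : ℤ) ^ (T.1 t).1 : ℤ) : ℂ) := by
  rw [wordRep_polytabloid_apply]
  push_cast
  refine Finset.sum_congr rfl fun σ _ => ?_
  simp only [hg, StdFilling.rowWord_val]

/-- **The crucial nonzero term** (BCI: "there exists `π ∈ S_{nk}` such that
`⟨v_λ| g π |1^{⊗n} ⋯ k^{⊗n}⟩ ≠ 0`"), explicitly: if the rows of `T` are `< K`, two entries of a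
column of `T` differ by the difference of their rows (column reading), and the word `s` carries the
letter `t mod K` at position `t` (the block word `u_{id}` read through the mixing permutation), then
the integer `⟨s| g |e_T⟩ = ∑_{σ ∈ C_T} sgn σ ∏_t (s(σ t)+1)^{row t}` is nonzero — the product over the
columns of Vandermonde determinants on the distinct nodes `(t mod K) + 1`.
[cite: BurgisserChristandlIkenmeyer2011Even, §3] -/
theorem sum_colStab_sign_mul_prod_pow_ne_zero (hd : Y.cells.card = D) (T : StdFilling D Y)
    (hrow : ∀ t, (T.1 t).1 < K)
    (hcol : ∀ i j : Fin D, (T.1 i).2 = (T.1 j).2 → (i : ℕ) + (T.1 j).1 = (j : ℕ) + (T.1 i).1)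
    (s : Word N D) (hs : ∀ t, ((s t : Fin N) : ℕ) = (t : ℕ) % K) :
    (∑ σ ∈ T.colStab, (Equiv.Perm.sign σ : ℤ) *
      ∏ t, (((s (σ t) : Fin N) : ℕ) + 1 : ℤ) ^ (T.1 t).1) ≠ 0 := by
  classical
  intro h0
  -- as a complex number, the sum is a block-diagonal determinant
  have hval : ((∑ σ ∈ T.colStab, (Equiv.Perm.sign σ : ℤ) *
      ∏ t, (((s (σ t) : Fin N) : ℕ) + 1 : ℤ) ^ (T.1 t).1 : ℤ) : ℂ) =
      (Matrix.of fun t' t : Fin D => if (T.1 t').2 = (T.1 t).2 then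
        ((((s t' : Fin N) : ℕ) : ℂ) + 1) ^ (T.1 t).1 else 0).det := by
    rw [← sum_colStab_sign_mul_prod_eq_det]
    push_cast
    rfl
  rw [h0, Int.cast_zero, det_colMatrix_eq_prod] at hval
  refine Finset.prod_ne_zero_iff.mpr (fun a _ => ?_) hval.symm
  refine det_colBlock_ne_zero hd T (fun t => (((s t : Fin N) : ℕ) : ℂ) + 1) a ?_
  -- the nodes are injective on every column
  intro t t' ht ht' hx
  have h1 : (t : ℕ) % K = (t' : ℕ) % K := by
    rw [← hs, ← hs]
    exact_mod_cast add_right_cancel hx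
  have h2 := hcol t t' (by rw [ht, ht'])
  -- `t + r' = t' + r`, `t ≡ t' (mod K)`, `r, r' < K` force `r = r'`
  have h3 : ((t' : ℕ) + (T.1 t').1) % K = ((t' : ℕ) + (T.1 t).1) % K := by
    rw [← h2]
    exact Nat.ModEq.add_right _ h1.symm
  have h4 : (T.1 t').1 % K = (T.1 t).1 % K := Nat.ModEq.add_left_cancel' _ h3
  rw [Nat.mod_eq_of_lt (hrow t'), Nat.mod_eq_of_lt (hrow t)] at h4
  apply Fin.ext
  omega

/-- **The sum-of-squares identity** (BCI eq. (sumofsquares), with the symmetrisation made explicit):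
for the wreath symmetrisation `P y` of a tensor square `y = v ⊗ v` placed along a block-preserving
doubling `Θ`, summing `(g · P y)(u_i)` over all block-constant words `u_i` gives
`|S_K ≀ S_{2n}| · ∑_i ((g · v)(u_i))²`. [cite: BurgisserChristandlIkenmeyer2011Even, §3 (eq. sumofsquares)] -/
theorem sum_wordRep_blockSymmetrizer_tensorSquare (hn : 0 < n)
    (Θ : Fin 2 × Fin (K * n) ≃ Fin (K * (2 * n)))
    (hΘ : ∀ c q, blockIdx K (2 * n) (Θ (c, q)) = blockIdx K n q)
    (g : GL (Fin N) ℂ) (v : Word N (K * n) → ℂ) :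
    ∑ i : Fin K → Fin N, wordRep ℂ N (K * (2 * n)) g
        (blockSymmetrizer ℂ K (2 * n) fun w => ∏ c : Fin 2, v fun q => w (Θ (c, q)))
        (fun q => i (blockIdx K (2 * n) q)) =
      ((blockPermsFinset K (2 * n)).card : ℂ) *
        ∑ i : Fin K → Fin N, (wordRep ℂ N (K * n) g v fun q => i (blockIdx K n q)) ^ 2 := by
  have h2n : 0 < 2 * n := by omega
  simp only [wordRep_blockSymmetrizer, blockSymmetrizer_apply]
  rw [Finset.sum_comm]
  rw [Finset.sum_congr rfl fun τ hτ => sum_blockWord_comp_eq h2n (mem_blockPermsFinset.mp hτ)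
    (fun w => wordRep ℂ N (K * (2 * n)) g (fun w => ∏ c : Fin 2, v fun q => w (Θ (c, q))) w)]
  rw [Finset.sum_const, nsmul_eq_mul]
  congr 1
  refine Finset.sum_congr rfl fun i _ => ?_
  rw [wordRep_tensorPow]
  simp only [hΘ]
  rw [Finset.prod_const, Finset.card_univ, Fintype.card_fin]

/-- **The word-model form of the theorem**: for `μ ⊢ Kn` with at most `K ≤ N` parts (`n > 0`)
there is a nonzero `S_K ≀ S_{2n}`-invariant highest-weight vector of weight `2μ` in
`(ℂ^N)^{⊗ K·2n}`, i.e. `{2μ}` occurs in `Sym^K Sym^{2n} ℂ^N`. It is the wreath symmetrisation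
(projection to the plethysm) of the tensor square, along the doubling equivalence, of the
column-reading polytabloid read through the mixing permutation — BCI's `P σ|v_λ⟩^{⊗2}` up to
`π` — and it is nonzero because otherwise the sum of squares `∑_i ⟨u_i|g|v⟩²` of integers would
vanish while `⟨u_{id}|g|v⟩ ≠ 0`. [cite: BurgisserChristandlIkenmeyer2011Even, Theorem (§1.1) and §3] -/
theorem exists_wreathInvariant_hwv_two_nsmul (hn : 0 < n) (μ : Nat.Partition (K * n))
    (hμ : μ.parts.card ≤ K) (hKN : K ≤ N) :
    ∃ x : Word N (K * (2 * n)) → ℂ, x ≠ 0 ∧ (∀ τ ∈ blockPerms K (2 * n), wordPerm ℂ τ x = x) ∧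
      x ∈ highestWeightSpace (wordRep ℂ N (K * (2 * n))) (2 • Weight.ofPartition N μ) := by
  classical
  have hN : ∀ x ∈ μ.youngDiagram.cells, x.1 < N :=
    fun x hx => fst_lt_of_mem_youngDiagram μ (hμ.trans hKN) hx
  have hd := μ.card_cells_youngDiagram
  obtain ⟨T, hT⟩ := exists_colReading μ
  obtain ⟨π, hπ⟩ := exists_mixPerm K n
  obtain ⟨Θ, hΘ⟩ := exists_dblEquiv K n
  obtain ⟨g, hg⟩ := exists_vandGL N
  have hrow : ∀ t, (T.1 t).1 < K := fun t =>
    fst_lt_of_mem_youngDiagram μ hμ ((YoungDiagram.mem_cells _).2 (T.mem t))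
  -- `v = π⁻¹ e_T`, `y = v ⊗ v` along `Θ`, `x = P y`
  set v : Word N (K * n) → ℂ := wordPerm ℂ π (T.polytabloid ℂ hN) with hv
  set y : Word N (K * (2 * n)) → ℂ := fun w => ∏ c : Fin 2, v fun q => w (Θ (c, q)) with hy
  have hvw : v ∈ highestWeightSpace (wordRep ℂ N (K * n)) (Weight.ofPartition N μ) := by
    rw [← ydWeight_youngDiagram]
    exact wordPerm_mem_highestWeightSpace _ (T.polytabloid_mem hN hd)
  refine ⟨blockSymmetrizer ℂ K (2 * n) y, ?_, fun τ hτ => wordPerm_blockSymmetrizer ℂ hτ _,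
    blockSymmetrizer_mem_highestWeightSpace (tensorPow_mem_highestWeightSpace Θ hvw)⟩
  -- nonvanishing: the integers `Z i = ⟨u_i| g |v⟩`
  set Z : (Fin K → Fin N) → ℤ := fun i => ∑ σ ∈ T.colStab, (Equiv.Perm.sign σ : ℤ) *
    ∏ t, (((((fun q => i (blockIdx K n q)) ∘ ⇑π) (σ t) : Fin N) : ℕ) + 1 : ℤ) ^ (T.1 t).1 with hZ
  have hZi : ∀ i : Fin K → Fin N,
      wordRep ℂ N (K * n) g v (fun q => i (blockIdx K n q)) = (Z i : ℂ) := fun i => by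
    rw [hv, ← wordPerm_wordRep, wordPerm_apply, wordRep_polytabloid_apply_eq_intCast hN T hg]
  have hZ0 : Z (Fin.castLE hKN) ≠ 0 :=
    sum_colStab_sign_mul_prod_pow_ne_zero hd T hrow hT _ fun t => by
      rw [Function.comp_apply, Fin.val_castLE, hπ]
  intro h0
  have hsum := sum_wordRep_blockSymmetrizer_tensorSquare hn Θ hΘ g v
  rw [← hy, h0, map_zero] at hsum
  simp only [Pi.zero_apply, Finset.sum_const_zero, hZi] at hsum
  have hcard : ((blockPermsFinset K (2 * n)).card : ℂ) ≠ 0 :=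
    Nat.cast_ne_zero.mpr card_blockPermsFinset_pos.ne'
  have hsq : ∑ i : Fin K → Fin N, (Z i : ℂ) ^ 2 = 0 := (mul_eq_zero.mp hsum.symm).resolve_left hcard
  have hsqZ : ∑ i : Fin K → Fin N, Z i ^ 2 = 0 := by exact_mod_cast hsq
  have hall := (Finset.sum_eq_zero_iff_of_nonneg fun i _ => sq_nonneg (Z i)).mp hsqZ
  exact hZ0 (pow_eq_zero_iff two_ne_zero |>.mp (hall _ (Finset.mem_univ _)))

end Core

/-! ### G. Back to `ℂ[Sym^{2n} ℂ^d]`: the discharge -/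

section Assembly

/-- The constant `1 ∈ ℂ[Sym^m ℂ^d]` is a highest-weight vector of weight `0`. [folklore] -/
theorem one_mem_highestWeightSpace_coordRep_zero (d m : ℕ) :
    (1 : MvPolynomial (DegIdx (Fin d) m) ℂ) ∈ highestWeightSpace (coordRep (Fin d) ℂ m) 0 := by
  intro g _
  rw [coordRep_apply, map_one, weightChar,
    Finset.prod_eq_one fun i _ => by rw [Pi.zero_apply, zpow_zero], one_smul]

/-- The trivial weight occurs in every `⊕_δ Sym^δ Sym^m ℂ^d` (by the constants). [folklore] -/
theorem zero_mem_symSymOcc (d m : ℕ) : (0 : Weight (Fin d)) ∈ symSymOcc d m := by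
  rw [mem_symSymOcc_iff, hasHighestWeight_iff_exists]
  refine ⟨1, one_ne_zero, ?_⟩
  have h0 : (0 : Weight (Fin d)).dual = 0 := by
    funext i
    simp [Weight.dual]
  rw [h0]
  exact one_mem_highestWeightSpace_coordRep_zero d m

/-- **From the word model to `ℂ[Sym^{2n} ℂ^d]_k`** (the dictionary `formOfWord` of
`PlethysmStability.lean`, BIP (4.1), read through `Fin.rev`): a nonzero `S_k ≀ S_{2n}`-invariant
highest-weight vector of weight `2χ` in `(ℂ^d)^{⊗ k·2n}` yields `2χ ∈ symSymOcc d (2n)`.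
[cite: BurgisserIkenmeyerPanovaJAMS2019, §4 (4.1)] -/
theorem two_nsmul_mem_symSymOcc_of_exists {k n d : ℕ} {χ : Weight (Fin d)}
    (h : ∃ x : Word d (k * (2 * n)) → ℂ, x ≠ 0 ∧ (∀ τ ∈ blockPerms k (2 * n), wordPerm ℂ τ x = x) ∧
      x ∈ highestWeightSpace (wordRep ℂ d (k * (2 * n))) (2 • χ)) :
    (2 • χ) ∈ symSymOcc d (2 * n) := by
  obtain ⟨x, hx0, hxinv, hxw⟩ := h
  rw [mem_symSymOcc_iff, hasHighestWeight_iff_exists]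
  have hρ : StrictAnti (⇑(Fin.revPerm : Equiv.Perm (Fin d))) := fun _ _ h => Fin.rev_lt_rev.mpr h
  refine ⟨formOfWord (Fin.revPerm : Equiv.Perm (Fin d)) (2 * n) k x,
    formOfWord_ne_zero _ hxinv hx0, formOfWord_mem_highestWeightSpace (M := d) hρ hxinv ?_⟩
  have hw : (fun i => -((2 • χ).dual ((Fin.revPerm : Equiv.Perm (Fin d)) i))) = 2 • χ := by
    funext i
    simp [Weight.dual, Fin.revPerm_apply, Fin.rev_rev]
  rw [hw]
  exact hxw

/-- **Bürgisser–Christandl–Ikenmeyer's theorem (Weintraub's conjecture), proved**: for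
`k ≤ d` and every partition `λ ⊢ kn` with at most `k` parts, `{2λ}` occurs in
`Sym^k(Sym^{2n} ℂ^d)` — the discharge of the named fact `BCI2011_evenPlethysm`. The proof is the
printed one (§3: `⟨v|ψ⟩ = ∑_i ⟨w|i_1^{⊗n}⋯i_k^{⊗n}⟩² > 0` for `|v⟩ = σ|w⟩^{⊗2}`,
`|w⟩ = π⁻¹g⁻¹|v_λ⟩`, `|ψ⟩ = (∑_i |i⟩^{⊗2n})^{⊗k}`), made explicit: `π` is the mixing permutation of
the column-reading tableau, `g` the Vandermonde matrix, and the projection of `σ(π⁻¹|v_λ⟩)^{⊗2}`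
to `Sym^k Sym^{2n} V` (`exists_wreathInvariant_hwv_two_nsmul`) is the highest-weight vector,
nonzero by the sum of squares; the cases `k = 0` or `n = 0` (`λ = 0`) are witnessed by the
constants.
[cite: BurgisserChristandlIkenmeyer2011Even, Theorem (§1.1) and §3] -/
theorem BCI2011_evenPlethysm_holds : BCI2011_evenPlethysm := by
  intro k n d hkd χ hpoly hsize hzero
  -- the trivial cases `k = 0`, `n = 0`: `χ = 0`
  by_cases hk : k = 0
  · have hχ : χ = 0 := funext fun i => hzero i (by rw [hk]; exact Nat.zero_le _)
    rw [hχ, smul_zero]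
    exact zero_mem_symSymOcc d _
  by_cases hn : n = 0
  · have hsum : ∑ i, χ i = 0 := by
      rw [hn, mul_zero, Nat.cast_zero] at hsize
      exact hsize
    have hχ : χ = 0 := funext fun i =>
      (Finset.sum_eq_zero_iff_of_nonneg fun j _ => hpoly.2 j).mp hsum i (Finset.mem_univ i)
    rw [hχ, smul_zero]
    exact zero_mem_symSymOcc d _
  -- the partition `μ` with `χ = (μ_1, …, μ_k, 0, …, 0)`
  have hkn : χ.size.toNat = k * n := by rw [hsize, Int.toNat_natCast]
  obtain ⟨μ, ⟨hμd, hμχ⟩, -⟩ := Weight.existsUnique_eq_ofPartition_holds hpoly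
  suffices H : ∀ (m : ℕ) (ν : Nat.Partition m), m = k * n → ν.parts.card ≤ d →
      Weight.ofPartition d ν = χ → (2 • χ) ∈ symSymOcc d (2 * n) from H _ μ hkn hμd hμχ
  intro m ν hm hνd hνχ
  subst hm
  -- `ν` has at most `k` parts since `χ_i = 0` for `i ≥ k`
  have hνk : ν.parts.card ≤ k := by
    by_contra hlt
    push Not at hlt
    have hkd' : k < d := lt_of_lt_of_le hlt hνd
    have h1 := hzero ⟨k, hkd'⟩ le_rfl
    rw [← hνχ, Weight.ofPartition_apply] at h1
    have hlen : k < ν.sortedParts.length := by rw [Nat.Partition.length_sortedParts]; exact hlt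
    rw [List.getD_eq_getElem _ _ hlen, Nat.cast_eq_zero] at h1
    exact (ν.pos_of_mem_sortedParts (List.getElem_mem hlen)).ne' h1
  rw [← hνχ]
  exact two_nsmul_mem_symSymOcc_of_exists
    (exists_wreathInvariant_hwv_two_nsmul (Nat.pos_of_ne_zero hn) ν hνk hkd)

end Assembly


end Literature.Barriers.ValiantsHypothesis
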